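import Literature.NumberTheory.Automorphic.GL2CCoeffRepComplex
import Literature.NumberTheory.Automorphic.AutomorphicRepLieActionGL
import HarnessLib

/-!
# Automorphic forms on `GL₂` over an imaginary quadratic field read on `GL₂(ℂ) × GL₂(𝔸_K^∞)`:
# the point `(M, c)`, one-parameter subgroups, rational points, the level

For `K` totally complex with one infinite place, an automorphic form `φ : GL₂(𝔸_K) → ℂ` is read at
the points `pt M c = ofComplexGL M · (1, c)` (`M ∈ GL₂(ℂ)`, `c ∈ GL₂(𝔸_K^∞)`).  This file records
the bookkeeping used by the Eichler–Shimura–Harder family (`GL2CESHFamily`):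

* `pt_mul_expGL` — `pt (M exp sY) c = pt M c · (exp (s φ_{w₀} Y), 1)`, hence
  `hasDerivAt_pt_mul_expGL` — **`d/ds|₀ φ(pt (M exp sY) c) = (φ_{w₀}(Y) φ)(pt M c)`**, the Lie
  derivative (`IsArchSmooth`);
* `pt_rat_mul` — **rational points**: `pt (σ₀γ · M) (γ · c) = γ_𝔸 · pt M c` with
  `γ_𝔸 ∈ GL₂(K) ≤ GL₂(𝔸_K)` (`ImaginaryQuadratic.ext_of_toComplexGL_of_sndHom`), hence
  `apply_pt_rat_mul` — **automorphy** `φ(pt (σ₀γ M) (γ c)) = φ(pt M c)` for `φ ∈ W`;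
* `apply_pt_mul_level` — right invariance under the finite level transported to `c`.
[cite: BorelJacquet1979, §4.1–4.2] [cite: Harder1987, §3.1]

The definition `pt` has a body; theorems otherwise; no named fact.
-/

noncomputable section

-- Mathlib idiom (Mathlib/Algebra/Lie/OfAssociative.lean), as in `ArchCoeffComplexPlaceCasimir`.
attribute [local instance 100] LieRing.ofAssociativeRing

open scoped Matrix ComplexConjugate MatrixGroups Topology Matrix.Norms.Operator
open Complex Filter

namespace Literature.NumberTheory.Automorphic

namespace GL2CAut

open scoped Classical
open _root_.NumberField _root_.NumberField.InfinitePlace _root_.NumberField.mixedEmbedding IsDedekindDomain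
open RealMatrixGroup ComplexPlace ImaginaryQuadratic GL2CCoeff

variable (K : Type) [Field K] [NumberField K] [IsTotallyComplex K]

/-- **The point `(M, c) ∈ GL₂(𝔸_K)`**: `ofComplexGL M · (1, c)`. [cite: BorelJacquet1979, §4.1] -/
def pt (M : GL (Fin 2) ℂ) (c : BigHeckeGLn.FiniteAdelicGL 2 K) : GL (Fin 2) (AdeleRing (𝓞 K) K) :=
  ofComplexGL K 2 M * GLn.ofFinite 2 K c

variable {K}

/-- Unfolding. [folklore] -/
theorem pt_def (M : GL (Fin 2) ℂ) (c : BigHeckeGLn.FiniteAdelicGL 2 K) :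
    pt K M c = ofComplexGL K 2 M * GLn.ofFinite 2 K c := rfl

/-- `pt (M N) c = ofComplexGL M · pt N c`. [folklore] -/
theorem pt_mul_left (M N : GL (Fin 2) ℂ) (c : BigHeckeGLn.FiniteAdelicGL 2 K) :
    pt K (M * N) c = ofComplexGL K 2 M * pt K N c := by
  rw [pt, pt, map_mul, mul_assoc]

/-- `pt (M N) c = pt M c · ofComplexGL N` (the archimedean and finite parts commute). [folklore] -/
theorem pt_mul_right (M N : GL (Fin 2) ℂ) (c : BigHeckeGLn.FiniteAdelicGL 2 K) :
    pt K (M * N) c = pt K M c * ofComplexGL K 2 N := by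
  rw [pt, pt, map_mul, mul_assoc, mul_assoc, (commute_ofComplexGL_ofFinite N c).eq]

/-- `pt M (c u) = pt M c · (1, u)`. [folklore] -/
theorem pt_mul_finite (M : GL (Fin 2) ℂ) (c u : BigHeckeGLn.FiniteAdelicGL 2 K) :
    pt K M (c * u) = pt K M c * GLn.ofFinite 2 K u := by
  rw [pt, pt, map_mul, mul_assoc]

/-! ### One-parameter subgroups -/

/-- **`pt (M exp sY) c = pt M c · ofArch (exp (s φ_{w₀} Y))`.** [cite: BorelJacquet1979, §4.1] -/
theorem pt_mul_expGL (hK : Subsingleton (InfinitePlace K))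
    (M : GL (Fin 2) ℂ) (c : BigHeckeGLn.FiniteAdelicGL 2 K) (Y : Matrix (Fin 2) (Fin 2) ℂ) (s : ℝ) :
    pt K (M * expGL (s • Y)) c =
      pt K M c * GLn.ofInfinite 2 K ((archGroupGL 2 K).expMem (s • placeLie 2 (complexPlace K) Y) :
        GL (Fin 2) (mixedSpace K)) := by
  rw [pt_mul_right, ← embGL_expGL_smul K hK]
  rfl

omit [IsTotallyComplex K] in
/-- **The curve `s ↦ φ (g · ofArch (exp sX))` has derivative `(X φ)(g)` at `0`** for `φ` smooth in the
archimedean variable (as in `AutomorphicFormsGKModuleProofs`). [cite: BorelJacquet1979, §1.5] -/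
theorem hasDerivAt_expMem_smul_zero {hcpt : isCompact_glFiniteIntegralLevel 2 K}
    {φ : (AdelicGroupData.gl 2 K).Adelic → ℂ} (hφ : IsArchSmooth (AutomorphyDatum.gl 2 K hcpt).ofArch φ)
    (X : (AutomorphyDatum.gl 2 K hcpt).arch.lie) (g : (AdelicGroupData.gl 2 K).Adelic) :
    HasDerivAt (fun t : ℝ => φ (g * (AutomorphyDatum.gl 2 K hcpt).ofArch ((AutomorphyDatum.gl 2 K hcpt).arch.expMem (t • X))))
      (lieDeriv (AutomorphyDatum.gl 2 K hcpt).ofArch X φ g) 0 := by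
  set v : (AutomorphyDatum.gl 2 K hcpt).arch.lie.toSubmodule := ⟨X, X.2⟩ with hv
  have hd : DifferentiableAt ℝ (fun t : ℝ => φ (g * (AutomorphyDatum.gl 2 K hcpt).ofArch
      ((AutomorphyDatum.gl 2 K hcpt).arch.expMem (t • X)))) 0 := by
    have hF : DifferentiableAt ℝ (fun Y : (AutomorphyDatum.gl 2 K hcpt).arch.lie.toSubmodule =>
        φ (g * (AutomorphyDatum.gl 2 K hcpt).ofArch ((AutomorphyDatum.gl 2 K hcpt).arch.expMem ⟨Y, Y.2⟩)))
        ((fun t : ℝ => t • v) 0) := by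
      have h0 : (fun t : ℝ => t • v) 0 = 0 := zero_smul _ _
      rw [h0]
      exact ((hφ g).differentiable (by simp)).differentiableAt
    have hL : DifferentiableAt ℝ (fun t : ℝ => t • v) 0 := differentiableAt_id.smul_const _
    have hcomp : DifferentiableAt ℝ
        ((fun Y : (AutomorphyDatum.gl 2 K hcpt).arch.lie.toSubmodule =>
          φ (g * (AutomorphyDatum.gl 2 K hcpt).ofArch ((AutomorphyDatum.gl 2 K hcpt).arch.expMem ⟨Y, Y.2⟩))) ∘
          fun t : ℝ => t • v) 0 :=
      hF.comp 0 hL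
    exact hcomp
  exact hd.hasDerivAt

/-- **`d/ds|₀ φ(pt (M exp sY) c) = (φ_{w₀}(Y) φ)(pt M c)`** for `φ` smooth in the archimedean
variable. [cite: BorelJacquet1979, §1.5 and §4.1] -/
theorem hasDerivAt_pt_mul_expGL (hK : Subsingleton (InfinitePlace K)) {hcpt : isCompact_glFiniteIntegralLevel 2 K}
    {φ : (AdelicGroupData.gl 2 K).Adelic → ℂ} (hφ : IsArchSmooth (AutomorphyDatum.gl 2 K hcpt).ofArch φ)
    (M : GL (Fin 2) ℂ) (c : BigHeckeGLn.FiniteAdelicGL 2 K) (Y : Matrix (Fin 2) (Fin 2) ℂ) :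
    HasDerivAt (fun s : ℝ => φ (pt K (M * expGL (s • Y)) c))
      (lieDeriv (AutomorphyDatum.gl 2 K hcpt).ofArch (placeLie 2 (complexPlace K) Y) φ (pt K M c)) 0 := by
  have h := hasDerivAt_expMem_smul_zero hφ (placeLie 2 (complexPlace K) Y) (pt K M c)
  refine h.congr_of_eventuallyEq (Eventually.of_forall fun s => ?_)
  change φ (pt K (M * expGL (s • Y)) c) = _
  rw [pt_mul_expGL hK]
  rfl

/-- The same at a shifted time: `d/ds φ(pt (M exp sY) c) = (φ_{w₀}(Y) φ)(pt (M exp sY) c)`.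
[cite: BorelJacquet1979, §1.5] -/
theorem hasDerivAt_pt_mul_expGL_at (hK : Subsingleton (InfinitePlace K)) {hcpt : isCompact_glFiniteIntegralLevel 2 K}
    {φ : (AdelicGroupData.gl 2 K).Adelic → ℂ} (hφ : IsArchSmooth (AutomorphyDatum.gl 2 K hcpt).ofArch φ)
    (M : GL (Fin 2) ℂ) (c : BigHeckeGLn.FiniteAdelicGL 2 K) (Y : Matrix (Fin 2) (Fin 2) ℂ) (s₀ : ℝ) :
    HasDerivAt (fun s : ℝ => φ (pt K (M * expGL (s • Y)) c))
      (lieDeriv (AutomorphyDatum.gl 2 K hcpt).ofArch (placeLie 2 (complexPlace K) Y) φ (pt K (M * expGL (s₀ • Y)) c)) s₀ := by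
  have h := hasDerivAt_pt_mul_expGL hK hφ (M * expGL (s₀ • Y)) c Y
  -- reparametrise `s = s₀ + (s - s₀)`
  have h' : HasDerivAt (fun t : ℝ => φ (pt K (M * expGL (s₀ • Y) * expGL (t • Y)) c))
      (lieDeriv (AutomorphyDatum.gl 2 K hcpt).ofArch (placeLie 2 (complexPlace K) Y) φ (pt K (M * expGL (s₀ • Y)) c))
      (s₀ - s₀) := by
    rw [sub_self]; exact h
  have h2 := h'.comp_sub_const s₀ s₀
  refine h2.congr_of_eventuallyEq (Eventually.of_forall fun s => ?_)
  change φ (pt K (M * expGL (s • Y)) c) = φ (pt K (M * expGL (s₀ • Y) * expGL ((s - s₀) • Y)) c)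
  rw [mul_assoc, ← expGL_add_smul, add_sub_cancel]

/-! ### Rational points and automorphy -/

/-- **`ofComplexGL (σ₀ γ) · (1, γ) = γ_𝔸`**, the principal adelic point of `γ ∈ GL₂(K)`.
[cite: BorelJacquet1979, §4.2] -/
theorem ofComplexGL_rat_mul_ofFinite (h2 : Module.finrank ℚ K = 2) (γ : GL (Fin 2) K) :
    ofComplexGL K 2 (ratToComplexGL K 2 γ) * GLn.ofFinite 2 K (BigHeckeGLn.globalEmbedding 2 K γ) =
      Matrix.GeneralLinearGroup.map (algebraMap K (AdeleRing (𝓞 K) K)) γ := by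
  refine ext_of_toComplexGL_of_sndHom h2 ?_ ?_
  · rw [map_mul, toComplexGL_ofComplexGL, toComplexGL_ofFinite, mul_one, toComplexGL_map_algebraMap]
  · rw [map_mul, sndHom_ofComplexGL, one_mul, GLn.sndHom_ofFinite, sndHom_map_algebraMap]
    rfl

/-- **Rational points**: `pt (σ₀γ · M) (γ · c) = γ_𝔸 · pt M c`. [cite: BorelJacquet1979, §4.2] -/
theorem pt_rat_mul (h2 : Module.finrank ℚ K = 2) (γ : GL (Fin 2) K) (M : GL (Fin 2) ℂ)
    (c : BigHeckeGLn.FiniteAdelicGL 2 K) :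
    pt K (ratToComplexGL K 2 γ * M) (BigHeckeGLn.globalEmbedding 2 K γ * c) =
      Matrix.GeneralLinearGroup.map (algebraMap K (AdeleRing (𝓞 K) K)) γ * pt K M c := by
  rw [pt, pt, map_mul, map_mul, ← ofComplexGL_rat_mul_ofFinite h2 γ, mul_assoc, mul_assoc]
  congr 1
  rw [← mul_assoc, (commute_ofComplexGL_ofFinite M (BigHeckeGLn.globalEmbedding 2 K γ)).eq, mul_assoc]

omit [IsTotallyComplex K] in
/-- The principal adelic points are rational points of the `GL₂` datum. [folklore] -/
theorem map_algebraMap_mem_arithmeticSubgroup (γ : GL (Fin 2) K) :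
    Matrix.GeneralLinearGroup.map (algebraMap K (AdeleRing (𝓞 K) K)) γ ∈ (AdelicGroupData.gl 2 K).arithmeticSubgroup :=
  ⟨γ, rfl⟩

omit [IsTotallyComplex K] in
/-- Elements of the space of automorphic forms (a span) are left `G(K)`-invariant. [cite: BorelJacquet1979, §4.2] -/
theorem isLeftInvariant_of_mem_automorphicForms {hcpt : isCompact_glFiniteIntegralLevel 2 K}
    {φ : (AdelicGroupData.gl 2 K).Adelic → ℂ} (hφ : φ ∈ automorphicForms (AutomorphyDatum.gl 2 K hcpt)) :
    IsLeftInvariant (AdelicGroupData.gl 2 K) φ := by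
  let S : Submodule ℂ ((AdelicGroupData.gl 2 K).Adelic → ℂ) :=
    { carrier := {ψ | IsLeftInvariant (AdelicGroupData.gl 2 K) ψ}
      zero_mem' := fun _ _ _ => rfl
      add_mem' := fun ha hb γ hγ g => by simp only [Pi.add_apply, ha γ hγ g, hb γ hγ g]
      smul_mem' := fun c _ ha γ hγ g => by simp only [Pi.smul_apply, ha γ hγ g] }
  have h : automorphicForms (AutomorphyDatum.gl 2 K hcpt) ≤ S :=
    Submodule.span_le.2 fun ψ hψ => hψ.leftInvariant
  exact h hφ

/-- **Automorphy**: `φ(pt (σ₀γ M) (γ c)) = φ(pt M c)` for `φ ∈ W` (left `GL₂(K)`-invariance of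
automorphic forms). [cite: BorelJacquet1979, §4.2] -/
theorem apply_pt_rat_mul (h2 : Module.finrank ℚ K = 2) {hcpt : isCompact_glFiniteIntegralLevel 2 K}
    (π : AutomorphicRepData (AutomorphyDatum.gl 2 K hcpt)) {φ : (AdelicGroupData.gl 2 K).Adelic → ℂ} (hφ : φ ∈ π.W)
    (γ : GL (Fin 2) K) (M : GL (Fin 2) ℂ) (c : BigHeckeGLn.FiniteAdelicGL 2 K) :
    φ (pt K (ratToComplexGL K 2 γ * M) (BigHeckeGLn.globalEmbedding 2 K γ * c)) = φ (pt K M c) := by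
  rw [pt_rat_mul h2]
  exact isLeftInvariant_of_mem_automorphicForms (π.stable.le_automorphicForms hφ) _
    (map_algebraMap_mem_arithmeticSubgroup γ) _

/-! ### The level -/

/-- **Right invariance under the level**, transported to `c`: if `φ` is fixed by right translation
by `(1, u)` then `φ(pt M (c u)) = φ(pt M c)`. [cite: BorelJacquet1979, §4.2] -/
theorem apply_pt_mul_of_fixed {φ : (AdelicGroupData.gl 2 K).Adelic → ℂ} {u : BigHeckeGLn.FiniteAdelicGL 2 K}
    (hu : rightTranslation (AdelicGroupData.gl 2 K) (GLn.ofFinite 2 K u) φ = φ)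
    (M : GL (Fin 2) ℂ) (c : BigHeckeGLn.FiniteAdelicGL 2 K) : φ (pt K M (c * u)) = φ (pt K M c) := by
  have := congrFun hu (pt K M c)
  rw [rightTranslation_apply] at this
  rw [pt_mul_finite]
  exact this

end GL2CAut

end Literature.NumberTheory.Automorphic

end
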